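import Summits.QuantumFields.BalabanUV.Beta.SymBorderedHessianStepBlind
import Summits.QuantumFields.BalabanUV.Beta.RelInvSymBorderedHessian
import Summits.QuantumFields.BalabanUV.Beta.RelInvBorderedHessianStep

/-!
# `BalabanUV.Beta.RelInvSymBorderedHessianStep` — binder row D1, JSB12SYM-SPINE v1.1 (Σ3) step K3 part b: THE STEP ABSORPTION
# `(bhKStep (j+1) ∘ KInvStep Lc (j+1)) ∘ Π̂ᵀ_sym = Π̂ᵀ_sym,C` AND `RelInv (coDressKSymAt ρ_c Lc (KInvStep Lc j)) (bhKStep d Lc j) (symEc Lc)` AT EVERY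
# STEP `j` (pattern `RelInvBorderedHessianStep` §1–3 verbatim for the straight candidate; the paired field–field identity
# `sum_mul_comp_bhKStep_KInvStep_inl_inl`, the mixed∕multiplier entries `comp_bhKStep_KInvStep_*` and `trK_KInvStep` BY NAME; K2-b
# `isBlockConst_codiff₁_rowSym` for the source)

CHART (RULING R-D1-g25-4): chart (II), centred root; hSX separate.  Only the STRAIGHT candidate `bhKStep` (no symmetrised analogue of the comb-rooted
`bhKStepAt` is posited).
HONEST FRAMING (cell contract, verbatim): «discharging `BetaPertH` makes Bałaban's UV stability UNCONDITIONAL — a real constructive-QFT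
result; it is NOT the continuum limit and NOT the Clay problem.»  THIS MODULE DISCHARGES NOTHING of `BetaPertH` ∕ row D1: [folklore] bookkeeping
of OUR objects; it is the step-`j` relative-inverse socket of the symmetrised letter-level wiring; JsB12Sym 0∕4 binders.  0 sorry, 0 `def … : Prop`,
nothing cited.  NOT D1, NOT BetaPertH, NOT continuum, NOT Clay.
HONEST DEPENDENCY (verbatim): «continuum YM on T⁴ ⇐ BetaPertH ∧ nine spine estimates (0/9 proved); BetaPertH ⇐ (D1) ∧ (D4) ∧ CAP+tail;
G-an2-4 gates asym, D1 and NE2/3/4.»  ABSOLUTE RULE (cell, verbatim): «No internally-minted statement may enter as a cited fact. Every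
hypothesis is either kernel-proved in this package or a verbatim quotation of a PUBLISHED theorem with page reference.»
Unit `b2b-balaban-beta-an2` gen 25 (row-D1 owner), 2026-08-21.
-/

namespace Summit.QuantumFields.BalabanUV.Beta.RelInvSymBorderedHessianStep

noncomputable section

open Finset
open scoped BigOperators Nat
open Literature.Probability.LatticeModels (TorusSite Torus.proj Torus.proj_apply)
open Literature.MathematicalPhysics.QuantumFieldTheory
open Literature.MathematicalPhysics.QuantumFieldTheory.Balaban1983to89
open Literature.MathematicalPhysics.QuantumFieldTheory.Balaban1983to89.Beta
open ExpKernelCalculus (MKer comp)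
open AffineAveraging (Form0 Form1 Form2 Site box toSite unitVec unitVec_apply dz codiff₁)
open AffineReproduction (IsBlockConst)
open AveragingContoursRooted (ctr ctrOff ctrOff_mem_box)
open KKTFluctuationKernel (delta1 delta1_apply)
open LatticeForm (quo)
open OneStepResolventKernel (Fib KInv quo_zsmul eq_zsmul_quo_of_proj proj_zsmul)
open OneStepKernelFamily (KInvStep KInvStep_inr_off)
open Summit.QuantumFields.BalabanUV.Beta.TameKernelCalculus
open Summit.QuantumFields.BalabanUV.Beta.ChartConjugationRelative (RelInv spr_comp)
open Summit.QuantumFields.BalabanUV.Beta.AxialDressingRooted (cube mem_cube one_le_of_neZero KInvStep_inr_off')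
open Summit.QuantumFields.BalabanUV.Beta.BorderedHessian (bhK bhKStep bhKStep_zero spr_bhKStep spr_KInvStep sum_mul_comp_bhKStep_KInvStep_inl_inl
  comp_bhKStep_KInvStep_inr_inl comp_bhKStep_KInvStep_inl_inr comp_bhKStep_KInvStep_inr_inr trK_bhKStep_succ sgnK comp_sgnK sgnK_eq_self
  comp_KInvStep_bhKStep)
open Summit.QuantumFields.BalabanUV.Beta.BubbleParity (trK_KInvStep)
open Summit.QuantumFields.BalabanUV.Beta.SymmetrisedDressingMatrix
open Summit.QuantumFields.BalabanUV.Beta.SymmetrisedDressingKernel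
open Summit.QuantumFields.BalabanUV.Beta.SymSliceProjectorKernel (symEc)
open Summit.QuantumFields.BalabanUV.Beta.SymSliceProjectorSpread (spr_symEc)
open Summit.QuantumFields.BalabanUV.Beta.SymSliceProjectorRules (piKSymBmC piKSymBmC_inl_inl piKSymBmC_inl_inr piKSymBmC_inr_inl piKSymBmC_inr_inr
  comp_symEc_coDressKSymAt comp_coDressKSymAt_symEc)
open Summit.QuantumFields.BalabanUV.Beta.SymSliceProjectorFixed (comp_symEc_piKSymBmC comp_trK_piKSymBmC_symEc)
open Summit.QuantumFields.BalabanUV.Beta.SymGaugeMultiplierBlockMean (rowSym rowSym_eq_symAxProjBmAt isBlockConst_codiff₁_rowSym)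
open Summit.QuantumFields.BalabanUV.Beta.SymBorderedHessianBlind (piKSymBm_inl_inl_eq' sgnK_trK_piKSymBm)
open Summit.QuantumFields.BalabanUV.Beta.SymBorderedHessianStepBlind (comp_bhKStep_trK_piKSymBm comp_piKSymBm_bhKStep)
open Summit.QuantumFields.BalabanUV.Beta.RelInvSymBorderedHessian (ctr_eq relInv_coDressKSymAt_KInv)

variable {d : ℕ} {Lc : ℕ} [NeZero Lc]

/-! ## §1 The absorption: `(bhKStep (j+1) ∘ KInvStep Lc (j+1)) ∘ piKSymBm = piKSymBmC` -/

/-- [folklore] The row `(β, z)` of `Π^{sym}_bm`, read as the `(inl ·, inl β)` column of `piKSymBm` at `z`, IS `rowSym` (window redundancy). -/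
theorem piKSymBm_col_eq_rowSym {r : Fin (d + 1) → ℕ} (hr : r ∈ box (d + 1) Lc) (β : Fin (d + 1)) (z : Fin (d + 1) → ℤ) :
    (fun l w => piKSymBm (toSite r) Lc w z (Sum.inl l) (Sum.inl β)) = rowSym (toSite r) Lc β z := by
  funext l w
  rw [piKSymBm_inl_inl_eq' (one_le_of_neZero Lc) hr, rowSym_eq_symAxProjBmAt]

/-- [folklore] **THE STEP ABSORPTION**: `comp (comp (bhKStep d Lc (j+1)) (KInvStep Lc (j+1))) (piKSymBm (toSite r) Lc) = piKSymBmC (toSite r) Lc`. -/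
theorem comp_comp_bhKStep_KInvStep_piKSymBm {r : Fin (d + 1) → ℕ} (hr : r ∈ box (d + 1) Lc) (j : ℕ) :
    comp (comp (bhKStep d Lc (j + 1)) (KInvStep (d := d) Lc (j + 1))) (piKSymBm (toSite r) Lc) = piKSymBmC (d := d) (toSite r) Lc := by
  classical
  have hLc : 1 ≤ Lc := one_le_of_neZero Lc
  set R : MKer (d + 1) (Fib d) := comp (bhKStep d Lc (j + 1)) (KInvStep (d := d) Lc (j + 1)) with hR
  funext x z a b
  unfold ExpKernelCalculus.comp
  rcases b with β | m
  · have e : ∀ w, ∑ f : Fib d, R x w a f * piKSymBm (toSite r) Lc w z f (Sum.inl β) =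
        ∑ l : Fin (d + 1), R x w a (Sum.inl l) * piKSymBm (toSite r) Lc w z (Sum.inl l) (Sum.inl β) := by
      intro w
      rw [Fintype.sum_sum_type]
      simp only [piKSymBm_inr_inl, mul_zero, Finset.sum_const_zero, add_zero]
    simp_rw [e]
    rcases a with κ | κ
    · set W : Finset (Fin (d + 1) → ℤ) := (cube (d + 1) Lc).image (fun v => z - v) with hW
      have hout : ∀ w, w ∉ W → ∀ l, piKSymBm (toSite r) Lc w z (Sum.inl l) (Sum.inl β) = 0 := by
        intro w hw l
        rw [piKSymBm_inl_inl, if_neg]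
        exact fun h => hw (Finset.mem_image.2 ⟨z - w, h, by abel⟩)
      rw [tsum_eq_sum (s := W) (fun w hw => Finset.sum_eq_zero fun l _ => by rw [hout w hw l, mul_zero])]
      set T : Finset (Fin (d + 1) × (Fin (d + 1) → ℤ)) := (Finset.univ : Finset (Fin (d + 1))) ×ˢ W with hT
      set a : Fin (d + 1) × (Fin (d + 1) → ℤ) → ℝ := fun q => piKSymBm (toSite r) Lc q.2 z (Sum.inl q.1) (Sum.inl β) with ha
      have hTa : ∀ q, q ∉ T → a q = 0 := by
        intro q hq
        have hw : q.2 ∉ W := fun h => hq (Finset.mem_product.2 ⟨Finset.mem_univ _, h⟩)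
        exact hout q.2 hw q.1
      have hbc : IsBlockConst Lc (codiff₁ (fun l w => a (l, w))) := by
        rw [show (fun l w => a (l, w)) = rowSym (toSite r) Lc β z from piKSymBm_col_eq_rowSym hr β z]
        exact isBlockConst_codiff₁_rowSym (toSite r) hLc β z
      have hmain := sum_mul_comp_bhKStep_KInvStep_inl_inl (d := d) (Lc := Lc) j T a hTa hbc x κ
      rw [hT, Finset.sum_product, Finset.sum_comm] at hmain
      rw [piKSymBmC_inl_inl]
      refine Eq.trans ?_ hmain
      refine Finset.sum_congr rfl fun w _ => Finset.sum_congr rfl fun l _ => ?_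
      rw [hR, ha, mul_comm]
    · rw [piKSymBmC_inr_inl]
      refine (tsum_congr fun w => ?_).trans tsum_zero
      refine Finset.sum_eq_zero fun l _ => ?_
      rw [hR, comp_bhKStep_KInvStep_inr_inl, zero_mul]
  · have e : ∀ w, ∑ f : Fib d, R x w a f * piKSymBm (toSite r) Lc w z f (Sum.inr m) = if w = z then R x z a (Sum.inr m) else 0 := by
      intro w
      rw [Fintype.sum_sum_type]
      simp only [piKSymBm_inl_inr, mul_zero, Finset.sum_const_zero, zero_add, piKSymBm_inr_inr]
      by_cases hw : w = z
      · subst hw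
        rw [if_pos rfl, Finset.sum_eq_single m (fun m' _ hm' => by rw [if_neg (fun h => hm' h.2), mul_zero])
          (fun h => (h (Finset.mem_univ m)).elim), if_pos ⟨rfl, rfl⟩, mul_one]
      · rw [if_neg hw]
        exact Finset.sum_eq_zero fun m' _ => by rw [if_neg (fun h => hw h.1), mul_zero]
    simp_rw [e]
    rw [tsum_eq_single z (fun w hw => if_neg hw), if_pos rfl, hR]
    rcases a with κ | κ
    · rw [comp_bhKStep_KInvStep_inl_inr, piKSymBmC_inl_inr]
    · rw [comp_bhKStep_KInvStep_inr_inr, piKSymBmC_inr_inr]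
      by_cases hxz : Torus.proj Lc x = 0 ∧ Torus.proj Lc z = 0
      · rw [if_pos hxz]
        by_cases hq : quo Lc x = quo Lc z ∧ κ = m
        · have hx : x = z := by rw [eq_zsmul_quo_of_proj hxz.1, eq_zsmul_quo_of_proj hxz.2, hq.1]
          rw [if_pos hq, if_pos ⟨hx, hq.2, hxz.1⟩]
        · rw [if_neg hq, if_neg]
          rintro ⟨hx, hκ, -⟩
          exact hq ⟨by rw [hx], hκ⟩
      · rw [if_neg hxz, if_neg]
        rintro ⟨hx, -, hpx⟩
        exact hxz ⟨hpx, by rw [← hx]; exact hpx⟩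

/-! ## §2 Rules 4 and 3 at step `j + 1` -/

/-- [folklore] `bhKStep (j+1) ∘ G_{j+1} = Π̂ᵀ_sym,C` for `G_{j+1} := Π̂_sym (KInvStep Lc (j+1)) Π̂ᵀ_sym` (centred root). -/
theorem comp_bhKStep_coDressKSymAt (j : ℕ) :
    comp (bhKStep d Lc (j + 1)) (coDressKSymAt (ctr (d + 1) Lc) Lc (KInvStep (d := d) Lc (j + 1))) = piKSymBmC (d := d) (ctr (d + 1) Lc) Lc := by
  have hLc : 1 ≤ Lc := one_le_of_neZero Lc
  have hr : ctrOff (d + 1) Lc ∈ box (d + 1) Lc := ctrOff_mem_box hLc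
  have sM : Spr (bhKStep d Lc (j + 1)) := spr_bhKStep (j + 1)
  have sP : Spr (piKSymBm (d := d) (ctr (d + 1) Lc) Lc) := by rw [ctr_eq]; exact spr_piKSymBm hLc hr
  have sPt : Spr (trK (piKSymBm (d := d) (ctr (d + 1) Lc) Lc)) := sP.trK
  have sK : Spr (KInvStep (d := d) Lc (j + 1)) := spr_KInvStep (j + 1)
  have hb : comp (bhKStep d Lc (j + 1)) (trK (piKSymBm (d := d) (ctr (d + 1) Lc) Lc)) = bhKStep d Lc (j + 1) := by
    rw [ctr_eq]; exact comp_bhKStep_trK_piKSymBm hr j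
  have habs : comp (comp (bhKStep d Lc (j + 1)) (KInvStep (d := d) Lc (j + 1))) (piKSymBm (ctr (d + 1) Lc) Lc) = piKSymBmC (ctr (d + 1) Lc) Lc := by
    rw [ctr_eq]; exact comp_comp_bhKStep_KInvStep_piKSymBm hr j
  rw [coDressKSymAt_eq, comp_assoc_tame sM.tame (spr_comp sPt sK).tame sP.tame, comp_assoc_tame sM.tame sPt.tame sK.tame, hb, habs]

/-- [folklore] **RULE 4 AT STEP `j+1`**: `(symEc ∘ bhKStep (j+1)) ∘ G_{j+1} = symEc`. -/
theorem rule4_bhKStep_sym (j : ℕ) :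
    comp (comp (symEc Lc) (bhKStep d Lc (j + 1))) (coDressKSymAt (ctr (d + 1) Lc) Lc (KInvStep (d := d) Lc (j + 1))) = symEc (d := d) Lc := by
  have hLc : 1 ≤ Lc := one_le_of_neZero Lc
  have hr : ctrOff (d + 1) Lc ∈ box (d + 1) Lc := ctrOff_mem_box hLc
  have sE : Spr (symEc (d := d) Lc) := spr_symEc hLc
  have sM : Spr (bhKStep d Lc (j + 1)) := spr_bhKStep (j + 1)
  have sG : Spr (coDressKSymAt (ctr (d + 1) Lc) Lc (KInvStep (d := d) Lc (j + 1))) := by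
    rw [ctr_eq]; exact spr_coDressKSymAt hLc hr (spr_KInvStep (j + 1))
  rw [← comp_assoc_tame sE.tame sM.tame sG.tame, comp_bhKStep_coDressKSymAt, comp_symEc_piKSymBmC hLc]

/-- [folklore] `G_{j+1} ∘ bhKStep (j+1) = trK Π̂ᵀ_sym,C` (the transposed chain). -/
theorem comp_coDressKSymAt_bhKStep (j : ℕ) :
    comp (coDressKSymAt (ctr (d + 1) Lc) Lc (KInvStep (d := d) Lc (j + 1))) (bhKStep d Lc (j + 1)) = trK (piKSymBmC (d := d) (ctr (d + 1) Lc) Lc) := by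
  have hLc : 1 ≤ Lc := one_le_of_neZero Lc
  have hr : ctrOff (d + 1) Lc ∈ box (d + 1) Lc := ctrOff_mem_box hLc
  have sM : Spr (bhKStep d Lc (j + 1)) := spr_bhKStep (j + 1)
  have sP : Spr (piKSymBm (d := d) (ctr (d + 1) Lc) Lc) := by rw [ctr_eq]; exact spr_piKSymBm hLc hr
  have sPt : Spr (trK (piKSymBm (d := d) (ctr (d + 1) Lc) Lc)) := sP.trK
  have sK : Spr (KInvStep (d := d) Lc (j + 1)) := spr_KInvStep (j + 1)
  have hb : comp (piKSymBm (d := d) (ctr (d + 1) Lc) Lc) (bhKStep d Lc (j + 1)) = bhKStep d Lc (j + 1) := by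
    rw [ctr_eq]; exact comp_piKSymBm_bhKStep hr j
  have habs : comp (comp (bhKStep d Lc (j + 1)) (KInvStep (d := d) Lc (j + 1))) (piKSymBm (ctr (d + 1) Lc) Lc) = piKSymBmC (ctr (d + 1) Lc) Lc := by
    rw [ctr_eq]; exact comp_comp_bhKStep_KInvStep_piKSymBm hr j
  rw [coDressKSymAt_eq, ← comp_assoc_tame (spr_comp sPt sK).tame sP.tame sM.tame, hb, ← comp_assoc_tame sPt.tame sK.tame sM.tame,
    comp_KInvStep_bhKStep, ← trK_comp, habs]

/-- [folklore] **RULE 3 AT STEP `j+1`**: `(G_{j+1} ∘ bhKStep (j+1)) ∘ symEc = symEc`. -/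
theorem rule3_bhKStep_sym (j : ℕ) :
    comp (comp (coDressKSymAt (ctr (d + 1) Lc) Lc (KInvStep (d := d) Lc (j + 1))) (bhKStep d Lc (j + 1))) (symEc Lc) = symEc (d := d) Lc := by
  rw [comp_coDressKSymAt_bhKStep, comp_trK_piKSymBmC_symEc (one_le_of_neZero Lc)]

/-! ## §3 Rules 1–2 at every step and the relative inverse -/

/-- [folklore] **RULES 1–2 AT STEP `j`**: `symEc ∘ G_j = G_j` and `G_j ∘ symEc = G_j` (`KInvStep_inr_off`, `KInvStep_inr_off'`). -/
theorem symEc_rules_coDressKSymAt_KInvStep (j : ℕ) :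
    comp (symEc Lc) (coDressKSymAt (ctr (d + 1) Lc) Lc (KInvStep (d := d) Lc j)) = coDressKSymAt (ctr (d + 1) Lc) Lc (KInvStep (d := d) Lc j) ∧
      comp (coDressKSymAt (ctr (d + 1) Lc) Lc (KInvStep (d := d) Lc j)) (symEc Lc) = coDressKSymAt (ctr (d + 1) Lc) Lc (KInvStep (d := d) Lc j) :=
  ⟨comp_symEc_coDressKSymAt (one_le_of_neZero Lc) (spr_KInvStep j) (fun _x hx z m b => KInvStep_inr_off j hx m b z),
    comp_coDressKSymAt_symEc (one_le_of_neZero Lc) (spr_KInvStep j) (fun _z hz x a m => KInvStep_inr_off' j hz x a m)⟩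

/-- [folklore] **`RelInv G_{j+1} (bhKStep d Lc (j+1)) (symEc Lc)`** — all four rules at step `j + 1`. -/
theorem relInv_coDressKSymAt_KInvStep_succ_bhKStep (j : ℕ) :
    RelInv (coDressKSymAt (ctr (d + 1) Lc) Lc (KInvStep (d := d) Lc (j + 1))) (bhKStep d Lc (j + 1)) (symEc Lc) := by
  obtain ⟨h1, h2⟩ := symEc_rules_coDressKSymAt_KInvStep (d := d) (Lc := Lc) (j + 1)
  exact ⟨h1, h2, rule3_bhKStep_sym j, rule4_bhKStep_sym j⟩

/-- [folklore] **THE SYMMETRISED RELATIVE INVERSE AT EVERY STEP** `j` against the straight candidate (`j = 0`: K2-e `relInv_coDressKSymAt_KInv` with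
`bhKStep d Lc 0 = bhK Lc`, `KInvStep Lc 0 = KInv Lc`). -/
theorem relInv_coDressKSymAt_KInvStep_bhKStep :
    ∀ j : ℕ, RelInv (coDressKSymAt (ctr (d + 1) Lc) Lc (KInvStep (d := d) Lc j)) (bhKStep d Lc j) (symEc Lc)
  | 0 => by
      rw [bhKStep_zero]
      exact RelInvSymBorderedHessian.relInv_coDressKSymAt_KInvStep_zero
  | j + 1 => relInv_coDressKSymAt_KInvStep_succ_bhKStep j

end

end Summit.QuantumFields.BalabanUV.Beta.RelInvSymBorderedHessianStep
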